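import Literature.Geometry.ComplexAnalytic.PhamBrieskornJoinEigenvectors
import Literature.Geometry.ComplexAnalytic.PhamBrieskornFibreSymmetries
import HarnessLib

/-!
# The rotation of the last coordinate of the Pham–Brieskorn fibre has an eigenvector with eigenvalue `v` for every
# `v ∈ Ω_{aₙ₊₁}`; so no non-trivial rotation acts as the identity on `Hₙ₊₁(F; ℂ)` (Pham 1965; Milnor 1968, Thm. 9.1)

Layer `Literature/Geometry/ComplexAnalytic`; theorems only (no definition, no named fact). Written by the prover seat
`hodge-nonav-prover-Bx` (g16, cell `hodge-nonav`) as brick B2′ of the programme «A₃-TRACE» (binder hN `stub_a3NonComm` of crux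
K1-B `VeryGeneralSignCommutatorsInHg`, `Summits/HodgeConjecture/HodgeConjecture/Theses/SignSymmetricPowers.lean`,
stmt-HodgeConjecture-19716) — the MODEL FACT the unipotency argument needs: on the Milnor fibre `F = {u⁴ + Σ vⱼ² = 1}` of an
`A₃` point the involution `u ↦ −u` (the square of the weighted monodromy rotation) is NOT the identity on `Hₙ₊₁(F; ℂ)`.

Milnor §9 Thm. 9.1 / Pham: the coordinate torus `Ω_{a₀} × ⋯ × Ω_{aₙ₊₁}` acts on `H̃ₙ₊₁(J; ℂ) = ⊗ⱼ Ĩ(ℂΩ_{aⱼ})`, so every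
character non-trivial on each factor occurs (tree: `PhamBrieskorn.exists_eigenvector`). Taking the PRODUCT character
`u ↦ Πⱼ uⱼ` (non-trivial on each factor as soon as all `aⱼ ≥ 2`):

* `exists_eigenvector_prodChar` — a common eigenvector `x ≠ 0` of the torus on `Hₙ₊₁(J; ℂ)` with `(act u)_* x = (Πⱼ uⱼ) x`;
* `exists_eigenvector_rotate` — `(rotate v)_* x = v • x` for every `v ∈ Ω_{aₙ₊₁}` (the rotation of the last coordinate is
  `act (1, …, 1, v)`, tree `rotate_eq_act`);
* **`exists_eigenvector_rotateFibre`** — the same on the affine fibre `F` (transport along `J ↪ F`, a homotopy equivalence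
  intertwining the rotations: `joinHomotopyEquivFibre`, `inclusion_comp_rotate`);
* **`map_rotateFibre_ne_id`** — for `v ≠ 1`, `(rotateFibre v)_* ≠ id` on `Hₙ₊₁(F; ℂ)`; `exists_map_rotateFibre_ne` (pointwise form).

Nothing here is specific to `(2, …, 2, 4)`; no HC content; rung F-H1 not moved.

## References

* [Milnor1968] J. Milnor, Singular Points of Complex Hypersurfaces, Ann. of Math. Studies 61 (1968), §9, Thm. 9.1,
  Lemma 9.2 and p. 77.
* [Pham1965] F. Pham, Formules de Picard–Lefschetz généralisées et ramification des intégrales, Bull. Soc. Math. France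
  93 (1965) 333–367, §1.
-/

noncomputable section

open Complex ContinuousMap Set CategoryTheory
open Literature.AlgebraicTopology.SingularHomology

namespace Literature.Geometry.ComplexAnalytic

namespace PhamBrieskorn

variable {n : ℕ} {a : Fin (n + 2) → ℕ} (ha : ∀ i, a i ≠ 0) (h2 : ∀ i, 2 ≤ a i)

include ha h2 in
/-- **A common eigenvector of the coordinate torus on `Hₙ₊₁(J; ℂ)` for the product character**: `x ≠ 0` with
`(act u)_* x = (Πⱼ uⱼ) • x` for all `u` (all `aⱼ ≥ 2`). [cite: Milnor1968, §9 Thm. 9.1] [cite: Pham1965, §1] -/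
theorem exists_eigenvector_prodChar :
    ∃ x : singularHomology ℂ ℂ (join a) (n + 1), x ≠ 0 ∧
      ∀ u : Torus a, actRep a (n + 1) u x = (∏ j, ((u j : ℂˣ) : ℂ)) • x := by
  -- the product character `u ↦ Πⱼ uⱼ`
  let θ : Torus a →* ℂˣ :=
    { toFun := fun u => ∏ j, (u j : ℂˣ)
      map_one' := by simp
      map_mul' := fun u w => by
        rw [← Finset.prod_mul_distrib]
        exact Finset.prod_congr rfl fun j _ => by rw [Pi.mul_apply, Subgroup.coe_mul] }
  have hθ : ∀ u, θ u = ∏ j, (u j : ℂˣ) := fun u => rfl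
  -- non-trivial on every factor (`aⱼ ≥ 2`: a primitive `aⱼ`-th root is `≠ 1`)
  have hnt : ∀ j : Fin (n + 2), ∃ ζ : rootsOfUnity (a j) ℂ, θ (Pi.mulSingle j ζ) ≠ 1 := by
    intro j
    haveI : NeZero (a j) := ⟨by have := h2 j; omega⟩
    have hprim := Complex.isPrimitiveRoot_exp (a j) (NeZero.ne _)
    refine ⟨hprim.toRootsOfUnity, fun h => ?_⟩
    rw [hθ, Finset.prod_eq_single j (fun i _ hi => by rw [Pi.mulSingle_eq_of_ne hi]; rfl)
      (fun hj => absurd (Finset.mem_univ j) hj), Pi.mulSingle_eq_same] at h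
    have h' : Complex.exp (2 * Real.pi * I / (a j)) = 1 := by
      have := congrArg (fun x : ℂˣ => (x : ℂ)) h
      simpa [IsPrimitiveRoot.toRootsOfUnity, rootsOfUnity.coe_mkOfPowEq] using this
    exact hprim.ne_one (h2 j) h'
  obtain ⟨x, hx0, hx⟩ := exists_eigenvector ha θ hnt
  refine ⟨x, hx0, fun u => ?_⟩
  rw [hx u, hθ, Units.coe_prod]

include h2 in
/-- **The rotation of the last coordinate of the join has a `v`-eigenvector for every `v ∈ Ω_{aₙ₊₁}`** (one vector for
all `v`). [cite: Milnor1968, §9 Thm. 9.1 and p. 77] -/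
theorem exists_eigenvector_rotate :
    ∃ x : singularHomology ℂ ℂ (join a) (n + 1), x ≠ 0 ∧
      ∀ v : Omega (a (Fin.last (n + 1))),
        singularHomology.map ℂ ℂ (rotate a ha v : C(join a, join a)) (n + 1) x = (v : ℂ) • x := by
  obtain ⟨x, hx0, hx⟩ := exists_eigenvector_prodChar ha h2
  refine ⟨x, hx0, fun v => ?_⟩
  rw [rotate_eq_act ha v]
  change actRep a (n + 1) (torusOfLast ha v) x = _
  rw [hx, Fin.prod_univ_castSucc]
  congr 1
  have h1 : ∀ i : Fin (n + 1), (((torusOfLast ha v) i.castSucc : ℂˣ) : ℂ) = 1 := fun i => by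
    simp [torusOfLast]
  have h2' : (((torusOfLast ha v) (Fin.last (n + 1)) : ℂˣ) : ℂ) = (v : ℂ) := by
    simp [torusOfLast, toRoot]
  rw [Finset.prod_eq_one fun i _ => h1 i, one_mul, h2']

include h2 in
/-- **The rotation of the last coordinate of the affine Pham–Brieskorn fibre `F = {Σ zᵢ^{aᵢ} = 1}` has a common
eigenvector `y ≠ 0` in `Hₙ₊₁(F; ℂ)`, `(rotateFibre v)_* y = v • y` for every `v ∈ Ω_{aₙ₊₁}`** (all `aⱼ ≥ 2`): transport of
the join statement along the inclusion `J ↪ F`, a homotopy equivalence commuting with the rotations.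
[cite: Milnor1968, §9 Thm. 9.1, Lemma 9.2 and p. 77] [cite: Pham1965, §1] -/
theorem exists_eigenvector_rotateFibre :
    ∃ y : singularHomology ℂ ℂ (fibre a) (n + 1), y ≠ 0 ∧
      ∀ v : Omega (a (Fin.last (n + 1))),
        singularHomology.map ℂ ℂ (rotateFibre a ha v : C(fibre a, fibre a)) (n + 1) y = (v : ℂ) • y := by
  obtain ⟨x, hx0, hx⟩ := exists_eigenvector_rotate ha h2
  let e := joinHomotopyEquivFibre a ha
  let ι : C(join a, fibre a) := ⟨Set.inclusion join_subset_fibre, continuous_inclusion join_subset_fibre⟩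
  have hι : e.toFun = ι := joinHomotopyEquivFibre_toFun a ha
  let Φ := singularHomology.isoOfHomotopyEquiv ℂ ℂ e (n + 1)
  have hΦ : Φ.hom = singularHomology.map ℂ ℂ ι (n + 1) := by
    change singularHomology.map ℂ ℂ e.toFun (n + 1) = _
    rw [hι]
  have hinj : Function.Injective (singularHomology.map ℂ ℂ ι (n + 1)) := by
    rw [← hΦ]; exact ((forget (ModuleCat ℂ)).mapIso Φ).toEquiv.injective
  refine ⟨singularHomology.map ℂ ℂ ι (n + 1) x, fun h0 => hx0 (hinj (by rw [h0, map_zero])), fun v => ?_⟩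
  rw [← ModuleCat.comp_apply, ← singularHomology.map_comp, ← inclusion_comp_rotate a ha v, singularHomology.map_comp,
    ModuleCat.comp_apply, hx v, map_smul]

include h2 in
/-- Pointwise form: for `v ∈ Ω_{aₙ₊₁}`, `v ≠ 1`, some class of `Hₙ₊₁(F; ℂ)` is MOVED by `(rotateFibre v)_*`.
[cite: Milnor1968, §9 Thm. 9.1 and p. 77] -/
theorem exists_map_rotateFibre_ne (v : Omega (a (Fin.last (n + 1)))) (hv : (v : ℂ) ≠ 1) :
    ∃ y : singularHomology ℂ ℂ (fibre a) (n + 1),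
      singularHomology.map ℂ ℂ (rotateFibre a ha v : C(fibre a, fibre a)) (n + 1) y ≠ y := by
  obtain ⟨y, hy0, hy⟩ := exists_eigenvector_rotateFibre ha h2
  refine ⟨y, fun h => hy0 ?_⟩
  rw [hy v] at h
  have h1 : ((v : ℂ) - 1) • y = 0 := by rw [sub_smul, one_smul, h, sub_self]
  rcases smul_eq_zero.1 h1 with h3 | h3
  · exact absurd (sub_eq_zero.1 h3) hv
  · exact h3

include h2 in
/-- **No non-trivial rotation of the last coordinate acts as the identity on `Hₙ₊₁(F; ℂ)`** (all `aⱼ ≥ 2`); e.g. on the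
Milnor fibre `u⁴ + Σ vⱼ² = 1` of an `A₃` point the involution `u ↦ −u` is non-trivial on homology.
[cite: Milnor1968, §9 Thm. 9.1 and p. 77] [cite: Pham1965, §1] -/
theorem map_rotateFibre_ne_id (v : Omega (a (Fin.last (n + 1)))) (hv : (v : ℂ) ≠ 1) :
    (singularHomology.map ℂ ℂ (rotateFibre a ha v : C(fibre a, fibre a)) (n + 1)).hom ≠ LinearMap.id := by
  obtain ⟨y, hy⟩ := exists_map_rotateFibre_ne ha h2 v hv
  intro h
  exact hy (LinearMap.congr_fun h y)

end PhamBrieskorn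

end Literature.Geometry.ComplexAnalytic

end
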